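import Summits.HubbardSuperconductivity.HubbardSuperconductivity.Theorems.AnisotropyChordSpinMonotoneCompleteGraph
import Summits.HubbardSuperconductivity.HubbardSuperconductivity.Theorems.AnisotropyChordXXZHoppingFormula

/-!
# Route `AnisotropyChord`: the exchange (Dirac) form of the Casimir on an ARBITRARY graph —
# `⟨𝐒²⟩ ≤ c_G − 2⟨H_G(1)⟩` with equality on twin-symmetric states, and the graph-general bound on
# the monotonicity defect of `U_vt` / `M_Δ` (bears on `FerroSideChord` stmt-19089, `Concavity` stmt-8150)

Spin ½, `H(Δ) = xxzHamiltonian 1 G (−1) Δ` on a finite simple graph `G`, sector ground states.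
THEOREM VI of the theory seat (`hubbard-h0-rotor-theory-1`, cycle 4; block form landed as
`casimir_monotone_of_block`) rests on an affine IDENTITY `⟨𝐒²⟩ = c − a⟨H(1)⟩` on a block containing
the sector ground states.  This file replaces the identity by a graph-general INEQUALITY with a
located defect:

* `spinDot_one_mulVec_apply` — Dirac's exchange identity in vector form, `x ≠ y`:
  `(𝐒_x·𝐒_y ψ)(σ) = ½ ψ(σ ∘ swap_{xy}) − ¼ ψ(σ)` (`𝐒_x·𝐒_y = ½P_{xy} − ¼`);
* `re_expect_spinDot_one_le` — `Re⟨ψ, 𝐒_x·𝐒_y ψ⟩ ≤ ¼‖ψ‖²` (the tree's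
  `posSemidef_quarter_sub_spinDot_one`), `spinDot_one_mulVec_of_comp_swap` — with EQUALITY
  (`𝐒_x·𝐒_y ψ = ¼ψ`) when `ψ ∘ swap_{xy} = ψ`;
* `sum_edgeFinset_top_eq_add_compl`, `re_totalSpinSq_eq_graph` — on ANY graph
  `Re⟨ψ,𝐒²ψ⟩ = ¾|V|‖ψ‖² − 2Re⟨ψ,H_G(1)ψ⟩ + 2 Σ_{e ∈ E(Gᶜ)} Re⟨ψ, 𝐒·𝐒(e) ψ⟩`
  (Casimir = complete-graph exchange sum, split into the edges of `G`, which give `−H_G(1)`, and the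
  NON-edges);
* `re_totalSpinSq_le_graph` — hence `Re⟨ψ,𝐒²ψ⟩ ≤ (¾|V| + ½|E(Gᶜ)|)‖ψ‖² − 2Re⟨ψ,H_G(1)ψ⟩` for every
  `ψ`, and `re_totalSpinSq_eq_of_comp_swap` — equality for every `ψ` symmetric under all NON-adjacent
  transpositions;
* `casimir_monotone_of_upper_block` — Theorem VI, upper-block form: the inequality for `ψ₁`, the
  equality for `ψ₂` and Theorem V (`sectorGS_energyAt_antitone`, `Δ⋆ = 1`) give
  `⟨𝐒²⟩_{ψ₁} ≤ ⟨𝐒²⟩_{ψ₂}` for sector ground states at `Δ₁ < Δ₂ ≤ 1` — only the MORE ISOTROPIC state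
  has to be twin-symmetric;
* `totalSpinSq_sub_le_nonEdge_defect` — **graph-general defect bound**: for ANY finite graph, any
  sector, `Δ₁ < Δ₂ ≤ 1` and normalised sector ground states,
  `⟨𝐒²⟩_{ψ₁} − ⟨𝐒²⟩_{ψ₂} ≤ Σ_{e ∈ E(Gᶜ)} (½ − 2Re⟨ψ₂, 𝐒·𝐒(e) ψ₂⟩) = Σ_{xy ∉ E} (1 − Re⟨ψ₂, P_{xy}ψ₂⟩)`:
  a violation of the monotonicity `U_vt`/`M_Δ` (`…SpinMonotoneDefs`) can only come from SINGLET
  WEIGHT ON NON-ADJACENT PAIRS in the more isotropic ground state (on `W₁₃`,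
  `OneMagnon.not_graphGeneral_condensate_monotone`, that is where it comes from); on a complete
  multipartite graph the right-hand side vanishes by Perron–Frobenius symmetry (companion file
  `…SpinMonotoneCompleteMultipartite`: THEOREM VI in full, incl. the `2×2` torus `= K_{2,2}`).

Sources: P. A. M. Dirac, Proc. R. Soc. A 123 (1929) 714 (exchange operator); H. Tasaki, *Physics
and Mathematics of Quantum Many-Body Systems* (2020) §2.4, App. A.3; the route files cited.  No
definition is introduced.
-/

set_option linter.dupNamespace false

noncomputable section

namespace Summit.HubbardSuperconductivity.HubbardSuperconductivity.Theorems.AnisotropyChord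

open Matrix Complex Finset
open scoped ComplexOrder
open Literature.MathematicalPhysics.QuantumLattice

variable {V : Type*} [Fintype V] [DecidableEq V]

/-! ### Dirac's exchange identity and the exchange bound -/

omit [Fintype V] in
/-- A configuration with equal occupations at `x` and `y` is fixed by the transposition of `x, y`.
[folklore] -/
theorem comp_swap_eq_self_of_apply_eq {q : ℕ} {σ : V → Fin q} {x y : V} (h : σ x = σ y) :
    σ ∘ Equiv.swap x y = σ := by
  funext z
  simp only [Function.comp_apply]
  by_cases hzx : z = x
  · subst hzx; rw [Equiv.swap_apply_left, h]
  · by_cases hzy : z = y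
    · subst hzy; rw [Equiv.swap_apply_right, h]
    · rw [Equiv.swap_apply_of_ne_of_ne hzx hzy]

/-- **Dirac's exchange identity (vector form), spin ½**: for `x ≠ y` and every vector `ψ`,
`(𝐒_x·𝐒_y ψ)(σ) = ½ ψ(σ ∘ swap_{xy}) − ¼ ψ(σ)`, i.e. `𝐒_x·𝐒_y = ½ P_{xy} − ¼` with `P_{xy}` the
transposition of the tensor factors. Dirac (1929); Tasaki (2020) App. A.3. [folklore] -/
theorem spinDot_one_mulVec_apply {x y : V} (hxy : x ≠ y) (ψ : (V → Fin 2) → ℂ) (σ : V → Fin 2) :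
    ((spinDot 1 x y : Op V 2) *ᵥ ψ) σ =
      (1 / 2 : ℂ) * ψ (σ ∘ Equiv.swap x y) - (1 / 4 : ℂ) * ψ σ := by
  rw [LiebMattis.spinDot_eq_of_ne 1 hxy, Matrix.add_mulVec, Matrix.smul_mulVec, Matrix.add_mulVec,
    Pi.add_apply, Pi.smul_apply, Pi.add_apply, OneMagnon.raise_lower_mulVec_apply hxy]
  have hcomm : (onSite x (spinLower 1) * onSite y (spinRaise 1) : Op V 2) =
      onSite y (spinRaise 1) * onSite x (spinLower 1) :=
    onSite_mul_onSite_comm hxy _ _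
  rw [hcomm, OneMagnon.raise_lower_mulVec_apply (Ne.symm hxy)]
  have hzz : ((onSite x (SpinOperators.spinZ 1) * onSite y (SpinOperators.spinZ 1) : Op V 2) *ᵥ ψ) σ =
      (((1 : ℂ) / 2 - ((σ x : ℕ) : ℂ)) * ((1 : ℂ) / 2 - ((σ y : ℕ) : ℂ))) * ψ σ := by
    rw [SpinOperators.spinZ, LiebMattis.onSite_diagonal, LiebMattis.onSite_diagonal,
      diagonal_mul_diagonal, mulVec_diagonal]
    simp only [Nat.cast_one]
  rw [hzz, smul_eq_mul, Equiv.swap_comm y x]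
  have fin_two : ∀ t : Fin 2, t = 0 ∨ t = 1 := by decide
  rcases fin_two (σ x) with hx | hx <;> rcases fin_two (σ y) with hy | hy
  · rw [comp_swap_eq_self_of_apply_eq (hx.trans hy.symm)]
    simp [hx, hy]; ring
  · simp [hx, hy]; ring
  · simp [hx, hy]; ring
  · rw [comp_swap_eq_self_of_apply_eq (hx.trans hy.symm)]
    simp [hx, hy]; ring

/-- **The exchange bound** `Re⟨ψ, 𝐒_x·𝐒_y ψ⟩ ≤ ¼‖ψ‖²` for two spins ½ (`x ≠ y`; triplet `¼`,
singlet `−¾`). Tasaki (2020) App. A.3. [folklore] -/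
theorem re_expect_spinDot_one_le {x y : V} (hxy : x ≠ y) (ψ : (V → Fin 2) → ℂ) :
    (star ψ ⬝ᵥ ((spinDot 1 x y : Op V 2) *ᵥ ψ)).re ≤ (1 / 4 : ℝ) * (star ψ ⬝ᵥ ψ).re := by
  have h := (posSemidef_quarter_sub_spinDot_one (Λ := V) hxy).dotProduct_mulVec_nonneg ψ
  rw [Matrix.sub_mulVec, Matrix.smul_mulVec, Matrix.one_mulVec, dotProduct_sub, dotProduct_smul]
    at h
  have h2 := (Complex.le_def.1 h).1
  rw [Complex.zero_re, Complex.sub_re, smul_eq_mul] at h2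
  have e : ((1 / 4 : ℂ) * (star ψ ⬝ᵥ ψ)).re = (1 / 4 : ℝ) * (star ψ ⬝ᵥ ψ).re := by
    rw [show (1 / 4 : ℂ) = ((1 / 4 : ℝ) : ℂ) by norm_num, Complex.re_ofReal_mul]
  linarith

/-- **Equality case of the exchange bound**: a vector symmetric under the transposition of `x ≠ y`
is a triplet on that pair, `𝐒_x·𝐒_y ψ = ¼ ψ`. Tasaki (2020) App. A.3. [folklore] -/
theorem spinDot_one_mulVec_of_comp_swap {x y : V} (hxy : x ≠ y) {ψ : (V → Fin 2) → ℂ}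
    (hψ : ∀ σ, ψ (σ ∘ Equiv.swap x y) = ψ σ) :
    (spinDot 1 x y : Op V 2) *ᵥ ψ = (1 / 4 : ℂ) • ψ := by
  funext σ
  rw [spinDot_one_mulVec_apply hxy, hψ σ, Pi.smul_apply, smul_eq_mul]
  ring

/-- The exchange expectation of a twin-symmetric vector: `Re⟨ψ, 𝐒_x·𝐒_y ψ⟩ = ¼‖ψ‖²`. [folklore] -/
theorem re_expect_spinDot_one_of_comp_swap {x y : V} (hxy : x ≠ y) {ψ : (V → Fin 2) → ℂ}
    (hψ : ∀ σ, ψ (σ ∘ Equiv.swap x y) = ψ σ) :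
    (star ψ ⬝ᵥ ((spinDot 1 x y : Op V 2) *ᵥ ψ)).re = (1 / 4 : ℝ) * (star ψ ⬝ᵥ ψ).re := by
  rw [spinDot_one_mulVec_of_comp_swap hxy hψ, dotProduct_smul, smul_eq_mul,
    show (1 / 4 : ℂ) = ((1 / 4 : ℝ) : ℂ) by norm_num, Complex.re_ofReal_mul]

/-- The exchange expectation in transposition form:
`Re⟨ψ, 𝐒_x·𝐒_y ψ⟩ = ½ Re⟨ψ, ψ ∘ swap_{xy}⟩ − ¼‖ψ‖²` (`x ≠ y`). Dirac (1929). [folklore] -/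
theorem re_expect_spinDot_one_eq_swap {x y : V} (hxy : x ≠ y) (ψ : (V → Fin 2) → ℂ) :
    (star ψ ⬝ᵥ ((spinDot 1 x y : Op V 2) *ᵥ ψ)).re =
      (1 / 2 : ℝ) * (star ψ ⬝ᵥ (fun σ => ψ (σ ∘ Equiv.swap x y))).re
        - (1 / 4 : ℝ) * (star ψ ⬝ᵥ ψ).re := by
  have h : (spinDot 1 x y : Op V 2) *ᵥ ψ =
      (1 / 2 : ℂ) • (fun σ => ψ (σ ∘ Equiv.swap x y)) - (1 / 4 : ℂ) • ψ := by
    funext σ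
    rw [spinDot_one_mulVec_apply hxy, Pi.sub_apply, Pi.smul_apply, Pi.smul_apply, smul_eq_mul,
      smul_eq_mul]
  rw [h, dotProduct_sub, dotProduct_smul, dotProduct_smul, Complex.sub_re, smul_eq_mul, smul_eq_mul,
    show (1 / 2 : ℂ) = ((1 / 2 : ℝ) : ℂ) by norm_num, show (1 / 4 : ℂ) = ((1 / 4 : ℝ) : ℂ) by norm_num,
    Complex.re_ofReal_mul, Complex.re_ofReal_mul]

/-! ### The Casimir split along a graph: edges give `−H_G(1)`, non-edges the defect -/

omit [DecidableEq V] in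
/-- The edges of the complete graph are the edges of `G` together with those of its complement
(disjointly). [folklore] -/
theorem sum_edgeFinset_top_eq_add_compl (G : SimpleGraph V) [DecidableRel G.Adj] [DecidableEq V]
    {M : Type*} [AddCommMonoid M] (f : Sym2 V → M) :
    ∑ e ∈ (⊤ : SimpleGraph V).edgeFinset, f e =
      ∑ e ∈ G.edgeFinset, f e + ∑ e ∈ Gᶜ.edgeFinset, f e := by
  rw [← Finset.sum_union]
  · refine Finset.sum_congr ?_ fun _ _ => rfl
    ext e
    induction e using Sym2.ind with
    | h x y =>
      simp only [Finset.mem_union, SimpleGraph.mem_edgeFinset, SimpleGraph.mem_edgeSet,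
        SimpleGraph.top_adj, SimpleGraph.compl_adj]
      constructor
      · intro h
        by_cases ha : G.Adj x y
        · exact Or.inl ha
        · exact Or.inr ⟨h, ha⟩
      · rintro (h | h)
        · exact h.ne
        · exact h.1
  · rw [Finset.disjoint_left]
    intro e
    induction e using Sym2.ind with
    | h x y =>
      simp only [SimpleGraph.mem_edgeFinset, SimpleGraph.mem_edgeSet, SimpleGraph.compl_adj]
      tauto

/-- **The Casimir along a graph** (spin ½, any finite simple graph `G`):
`Re⟨ψ,𝐒²ψ⟩ = ¾|V|·‖ψ‖² − 2 Re⟨ψ, H_G(1) ψ⟩ + 2 Σ_{e ∈ E(Gᶜ)} Re⟨ψ, 𝐒·𝐒(e) ψ⟩`,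
`H_G(1) = xxzHamiltonian 1 G (−1) 1 = −Σ_{E(G)} 𝐒_x·𝐒_y`. Tasaki (2020) §2.4, App. A.3. [folklore] -/
theorem re_totalSpinSq_eq_graph (G : SimpleGraph V) [DecidableRel G.Adj] (ψ : (V → Fin 2) → ℂ) :
    (star ψ ⬝ᵥ ((totalSpinSq 1 : Op V 2) *ᵥ ψ)).re =
      (3 / 4 : ℝ) * (Fintype.card V : ℝ) * (star ψ ⬝ᵥ ψ).re
        - 2 * (star ψ ⬝ᵥ ((xxzHamiltonian 1 G (-1) 1 : Op V 2) *ᵥ ψ)).re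
        + 2 * ∑ e ∈ Gᶜ.edgeFinset, (star ψ ⬝ᵥ ((spinDotSym 1 e : Op V 2) *ᵥ ψ)).re := by
  rw [totalSpinSq_eq_casimir_add_two_smul_sum_edges, sum_edgeFinset_top_eq_add_compl G,
    xxz_at_one_eq_neg_heisenberg, heisenbergHamiltonian]
  simp only [add_mulVec, smul_mulVec, neg_mulVec, one_mulVec, Matrix.sum_mulVec, dotProduct_add,
    dotProduct_smul, dotProduct_neg, dotProduct_sum, Complex.add_re, Complex.neg_re, Complex.re_sum,
    smul_eq_mul, casimirValue, Complex.ofReal_one, one_smul, smul_add]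
  have e1 : ∀ (r : ℝ) (z : ℂ), ((r : ℂ) * z).re = r * z.re := fun r z => Complex.re_ofReal_mul r z
  have e2 : ∀ z : ℂ, ((2 : ℂ) * z).re = 2 * z.re := fun z => by simp [Complex.mul_re]
  simp only [e1, e2, Complex.re_sum]
  push_cast
  ring

/-- **Upper bound**: on any graph and for every vector,
`Re⟨ψ,𝐒²ψ⟩ ≤ (¾|V| + ½|E(Gᶜ)|)·‖ψ‖² − 2 Re⟨ψ, H_G(1) ψ⟩` (exchange bound on each non-edge).
[folklore] -/
theorem re_totalSpinSq_le_graph (G : SimpleGraph V) [DecidableRel G.Adj] (ψ : (V → Fin 2) → ℂ) :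
    (star ψ ⬝ᵥ ((totalSpinSq 1 : Op V 2) *ᵥ ψ)).re ≤
      ((3 / 4 : ℝ) * (Fintype.card V : ℝ) + (1 / 2 : ℝ) * (Gᶜ.edgeFinset.card : ℝ)) * (star ψ ⬝ᵥ ψ).re
        - 2 * (star ψ ⬝ᵥ ((xxzHamiltonian 1 G (-1) 1 : Op V 2) *ᵥ ψ)).re := by
  rw [re_totalSpinSq_eq_graph G ψ]
  have hsum : ∑ e ∈ Gᶜ.edgeFinset, (star ψ ⬝ᵥ ((spinDotSym 1 e : Op V 2) *ᵥ ψ)).re ≤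
      ∑ _e ∈ Gᶜ.edgeFinset, (1 / 4 : ℝ) * (star ψ ⬝ᵥ ψ).re := by
    refine Finset.sum_le_sum fun e he => ?_
    revert he
    induction e using Sym2.ind with
    | h x y =>
      intro he
      rw [SimpleGraph.mem_edgeFinset, SimpleGraph.mem_edgeSet] at he
      rw [spinDotSym_mk]
      exact re_expect_spinDot_one_le he.ne ψ
  rw [Finset.sum_const, nsmul_eq_mul] at hsum
  linarith

/-- **Equality for twin-symmetric vectors**: if `ψ ∘ swap_{xy} = ψ` for every NON-adjacent pair
`x ≠ y` of `G`, then `Re⟨ψ,𝐒²ψ⟩ = (¾|V| + ½|E(Gᶜ)|)·‖ψ‖² − 2 Re⟨ψ, H_G(1) ψ⟩`. [folklore] -/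
theorem re_totalSpinSq_eq_of_comp_swap (G : SimpleGraph V) [DecidableRel G.Adj]
    {ψ : (V → Fin 2) → ℂ}
    (hψ : ∀ x y, x ≠ y → ¬G.Adj x y → ∀ σ, ψ (σ ∘ Equiv.swap x y) = ψ σ) :
    (star ψ ⬝ᵥ ((totalSpinSq 1 : Op V 2) *ᵥ ψ)).re =
      ((3 / 4 : ℝ) * (Fintype.card V : ℝ) + (1 / 2 : ℝ) * (Gᶜ.edgeFinset.card : ℝ)) * (star ψ ⬝ᵥ ψ).re
        - 2 * (star ψ ⬝ᵥ ((xxzHamiltonian 1 G (-1) 1 : Op V 2) *ᵥ ψ)).re := by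
  rw [re_totalSpinSq_eq_graph G ψ]
  have hsum : ∑ e ∈ Gᶜ.edgeFinset, (star ψ ⬝ᵥ ((spinDotSym 1 e : Op V 2) *ᵥ ψ)).re =
      ∑ _e ∈ Gᶜ.edgeFinset, (1 / 4 : ℝ) * (star ψ ⬝ᵥ ψ).re := by
    refine Finset.sum_congr rfl fun e he => ?_
    revert he
    induction e using Sym2.ind with
    | h x y =>
      intro he
      rw [SimpleGraph.mem_edgeFinset, SimpleGraph.mem_edgeSet, SimpleGraph.compl_adj] at he
      rw [spinDotSym_mk]
      exact re_expect_spinDot_one_of_comp_swap he.1 (hψ x y he.1 he.2)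
  rw [hsum, Finset.sum_const, nsmul_eq_mul]
  ring

/-! ### Theorem VI, upper-block form, and the graph-general defect bound -/

/-- **Theorem VI, upper-block form.** If `Re⟨ψ₁,𝐒²ψ₁⟩ ≤ c − a·Re⟨ψ₁,H(1)ψ₁⟩` and
`Re⟨ψ₂,𝐒²ψ₂⟩ = c − a·Re⟨ψ₂,H(1)ψ₂⟩` with `a ≥ 0`, for normalised sector ground states `ψ₁` at `Δ₁` and
`ψ₂` at `Δ₂`, `Δ₁ < Δ₂ ≤ 1` (same sector, any graph, any spin, any `J`), then
`⟨𝐒²⟩_{ψ₁} ≤ ⟨𝐒²⟩_{ψ₂}` — Theorem V at the pencil point `Δ⋆ = 1` (`sectorGS_energyAt_antitone`).  Only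
the more isotropic state needs the identity. [folklore] -/
theorem casimir_monotone_of_upper_block {Λ : Type*} [Fintype Λ] [DecidableEq Λ] (n : ℕ)
    (G : SimpleGraph Λ) [DecidableRel G.Adj] {J M Δ₁ Δ₂ c a : ℝ} (ha : 0 ≤ a) (h12 : Δ₁ < Δ₂)
    (h2 : Δ₂ ≤ 1) {ψ₁ ψ₂ : TensorIndex Λ (n + 1) → ℂ}
    (g₁m : ψ₁ ∈ spinZSector (Λ := Λ) n M) (g₁n : star ψ₁ ⬝ᵥ ψ₁ = 1)
    (g₁e : xxzHamiltonian n G J Δ₁ *ᵥ ψ₁ =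
      ((lowestEnergyInSector n (xxzHamiltonian n G J Δ₁) M : ℝ) : ℂ) • ψ₁)
    (g₂m : ψ₂ ∈ spinZSector (Λ := Λ) n M) (g₂n : star ψ₂ ⬝ᵥ ψ₂ = 1)
    (g₂e : xxzHamiltonian n G J Δ₂ *ᵥ ψ₂ =
      ((lowestEnergyInSector n (xxzHamiltonian n G J Δ₂) M : ℝ) : ℂ) • ψ₂)
    (k₁ : (star ψ₁ ⬝ᵥ (totalSpinSq (Λ := Λ) n *ᵥ ψ₁)).re
        ≤ c - a * (star ψ₁ ⬝ᵥ (xxzHamiltonian n G J 1 *ᵥ ψ₁)).re)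
    (k₂ : (star ψ₂ ⬝ᵥ (totalSpinSq (Λ := Λ) n *ᵥ ψ₂)).re
        = c - a * (star ψ₂ ⬝ᵥ (xxzHamiltonian n G J 1 *ᵥ ψ₂)).re) :
    (star ψ₁ ⬝ᵥ (totalSpinSq (Λ := Λ) n *ᵥ ψ₁)).re ≤ (star ψ₂ ⬝ᵥ (totalSpinSq (Λ := Λ) n *ᵥ ψ₂)).re := by
  have hE := sectorGS_energyAt_antitone n G h12 h2 g₁m g₁n g₁e g₂m g₂n g₂e
  rw [k₂]
  nlinarith [mul_le_mul_of_nonneg_left hE ha]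

/-- **Graph-general defect bound for the monotonicity of `⟨𝐒²⟩` along the XXZ pencil** (spin ½, ANY
finite simple graph, any sector, `Δ₁ < Δ₂ ≤ 1`, normalised sector ground states `ψ₁`, `ψ₂` of
`H(Δ) = xxzHamiltonian 1 G (−1) Δ`):
`⟨𝐒²⟩_{ψ₁} − ⟨𝐒²⟩_{ψ₂} ≤ Σ_{e ∈ E(Gᶜ)} (½ − 2 Re⟨ψ₂, 𝐒·𝐒(e) ψ₂⟩)`.
Each summand is `≥ 0` and equals `1 − Re⟨ψ₂, P_e ψ₂⟩`, twice the singlet weight of `ψ₂` on the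
non-adjacent pair `e`: the monotonicity `U_vt`/`M_Δ` of `…SpinMonotoneDefs` can fail on a graph only
through singlet weight of the MORE ISOTROPIC ground state on NON-EDGES; on complete multipartite
graphs the bound is `0` (companion file `…SpinMonotoneCompleteMultipartite`).  Proof: exchange upper
bound for `ψ₁`, exact split for `ψ₂`, Theorem V at `Δ⋆ = 1`. [folklore] -/
theorem totalSpinSq_sub_le_nonEdge_defect (G : SimpleGraph V) [DecidableRel G.Adj] {M Δ₁ Δ₂ : ℝ}
    (h12 : Δ₁ < Δ₂) (h2 : Δ₂ ≤ 1) {ψ₁ ψ₂ : (V → Fin 2) → ℂ}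
    (g₁m : ψ₁ ∈ spinZSector (Λ := V) 1 M) (g₁n : star ψ₁ ⬝ᵥ ψ₁ = 1)
    (g₁e : (xxzHamiltonian 1 G (-1) Δ₁ : Op V 2) *ᵥ ψ₁ =
      ((lowestEnergyInSector 1 (xxzHamiltonian 1 G (-1) Δ₁) M : ℝ) : ℂ) • ψ₁)
    (g₂m : ψ₂ ∈ spinZSector (Λ := V) 1 M) (g₂n : star ψ₂ ⬝ᵥ ψ₂ = 1)
    (g₂e : (xxzHamiltonian 1 G (-1) Δ₂ : Op V 2) *ᵥ ψ₂ =
      ((lowestEnergyInSector 1 (xxzHamiltonian 1 G (-1) Δ₂) M : ℝ) : ℂ) • ψ₂) :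
    (star ψ₁ ⬝ᵥ ((totalSpinSq 1 : Op V 2) *ᵥ ψ₁)).re
        - (star ψ₂ ⬝ᵥ ((totalSpinSq 1 : Op V 2) *ᵥ ψ₂)).re ≤
      ∑ e ∈ Gᶜ.edgeFinset,
        ((1 / 2 : ℝ) - 2 * (star ψ₂ ⬝ᵥ ((spinDotSym 1 e : Op V 2) *ᵥ ψ₂)).re) := by
  have hE := sectorGS_energyAt_antitone 1 G h12 h2 g₁m g₁n g₁e g₂m g₂n g₂e
  have h1 := re_totalSpinSq_le_graph G ψ₁
  have h2' := re_totalSpinSq_eq_graph G ψ₂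
  rw [g₁n, Complex.one_re, mul_one] at h1
  rw [g₂n, Complex.one_re, mul_one] at h2'
  rw [Finset.sum_sub_distrib, Finset.sum_const, nsmul_eq_mul, ← Finset.mul_sum, h2']
  linarith

/-- The same bound in the condensate currency `Λ(ψ) = Re⟨ψ, S⁺_tot S⁻_tot ψ⟩` of the route
(`Re⟨ψ,𝐒²ψ⟩ = Λ(ψ) + (M² − M)‖ψ‖²` within the sector `S^z_tot = M`):
`Λ(ψ₁) − Λ(ψ₂) ≤ Σ_{e ∈ E(Gᶜ)} (½ − 2 Re⟨ψ₂, 𝐒·𝐒(e) ψ₂⟩)`. [folklore] -/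
theorem condensate_sub_le_nonEdge_defect (G : SimpleGraph V) [DecidableRel G.Adj] {M Δ₁ Δ₂ : ℝ}
    (h12 : Δ₁ < Δ₂) (h2 : Δ₂ ≤ 1) {ψ₁ ψ₂ : (V → Fin 2) → ℂ}
    (g₁m : ψ₁ ∈ spinZSector (Λ := V) 1 M) (g₁n : star ψ₁ ⬝ᵥ ψ₁ = 1)
    (g₁e : (xxzHamiltonian 1 G (-1) Δ₁ : Op V 2) *ᵥ ψ₁ =
      ((lowestEnergyInSector 1 (xxzHamiltonian 1 G (-1) Δ₁) M : ℝ) : ℂ) • ψ₁)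
    (g₂m : ψ₂ ∈ spinZSector (Λ := V) 1 M) (g₂n : star ψ₂ ⬝ᵥ ψ₂ = 1)
    (g₂e : (xxzHamiltonian 1 G (-1) Δ₂ : Op V 2) *ᵥ ψ₂ =
      ((lowestEnergyInSector 1 (xxzHamiltonian 1 G (-1) Δ₂) M : ℝ) : ℂ) • ψ₂) :
    (star ψ₁ ⬝ᵥ (((∑ x, onSite x (spinRaise 1)) * (∑ y, onSite y (spinLower 1)) : Op V 2) *ᵥ ψ₁)).re
        - (star ψ₂ ⬝ᵥ (((∑ x, onSite x (spinRaise 1)) * (∑ y, onSite y (spinLower 1)) : Op V 2) *ᵥ ψ₂)).re ≤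
      ∑ e ∈ Gᶜ.edgeFinset,
        ((1 / 2 : ℝ) - 2 * (star ψ₂ ⬝ᵥ ((spinDotSym 1 e : Op V 2) *ᵥ ψ₂)).re) := by
  have h := totalSpinSq_sub_le_nonEdge_defect G h12 h2 g₁m g₁n g₁e g₂m g₂n g₂e
  rw [OneMagnon.re_totalSpinSq_eq_condensate_add g₁m, OneMagnon.re_totalSpinSq_eq_condensate_add g₂m,
    g₁n, g₂n] at h
  simpa using h

end Summit.HubbardSuperconductivity.HubbardSuperconductivity.Theorems.AnisotropyChord
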